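import Literature.NumberTheory.Transcendental.ZilberClosedClassOver
import HarnessLib

/-!
# The closure-isomorphism language over a base, for exponential fields in an arbitrary universe

B. Zilber, *Pseudo-exponentiation on algebraically closed fields of characteristic zero*, Ann.
Pure Appl. Logic 132 (2005), Thm 1.1; M. Bays, J. Kirby, Algebra & Number Theory 12 (2018),
Remark 6.6, §8 (the language `L_{F_base}` naming the base by parameters), Thm 9.1; J. Kirby,
J. Symbolic Logic 75 (2010), Lemma 1.3, Prop. 3.5, Thm 3.3.

`ZilberCategoricityOver.lean`, `ZilberClosedClass.lean`, `ZilberHomogeneityTransfer.lean` and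
`ZilberClosedClassOver.lean` prove Zilber's categoricity theorem for Zilber fields in `Type`: the
relation symbols of their language `Language.eclIsoOver P` are indexed by pointed exponential
fields with carrier in `Type`, and the pointed closure `(ecl(x̄), x̄, ι_K)` of a tuple of a field
`K` must itself be such an index (`PointedEFieldOver.self`), which ties `K` to `Type`. Statements
quantifying over exponential fields `F : Type u` in every universe — such as the named facts of
`Literature/ModelTheory/ExponentialFields/DefinableAlgebraicNumbers.lean` (Kirby–Macintyre–Onshuus
2012, whose §3.5 Proposition is "quasiminimal excellence + Kirby 2010 Thm 3.3") — need the same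
machinery for fields in `Type u`. This file and its two sequels
(`ZilberHomogeneityTransferUniv.lean`, `ZilberClosedClassOverUniv.lean`) carry it over, inside the
namespace `Literature.NumberTheory.Transcendental.ZilberOverUniv` and with the SAME short names,
statements and proofs as the `Type` development (which is the instance `u = 0` up to the
universe of the index category; nothing there is changed or re-used under a different meaning):
the base `P` (in applications, the countable prime model `ecl^K(∅)` itself), the fields, the
carriers of the pointed exponential fields indexing the relation symbols, and the ambient Zilber
fields all live in `Type u`, and the language is `Language.eclIsoOver.{u} P : Language.{0, u+1}`.
The base-point vocabulary `EclBasePoint`, `basePt`, `EclIsoOver`, `ExponentialRingHom.codRestrictEcl`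
of `ZilberCategoricityOver.lean` has its base in `Type` and is therefore repeated here with base in
`Type u`; all other engines used by the `Type` development are already universe-polymorphic in
the tree (`SEACModel.*`, `ZilberCountableIso.exists_equiv`, `IsQuasiminimalPregeometryClass.*`,
`ZilberTransfer.mem_ecl_*`, …) and are used as they are.

## Contents (this file: the language, the dictionary, closed embeddings, the class)

* `EclBasePoint`, `basePt`, `EclIsoOver`, `eclIsoOver_iff`, `ExponentialRingHom.codRestrictEcl`
  (base in `Type u`); `PointedEFieldOver P n` (carrier in `Type u`), `Language.eclIsoOver P`, its
  structure on exponential fields `K : Type u` with a base point (`funMap_*`, `relMap_iff`).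
* `eclEquivOfEHom`, `ecl_range_comp_eHom`, `ecl_range_comp_val`; `PointedEFieldOver.self`,
  `relMap_self_over`, `eclIsoOver_of_eqQFType₂`, `realize_term_eHom_over`,
  `relMap_comp_iff_of_eHom_over`, `eqQFType₂_of_eclIsoOver`, `eqQFType₂_iff_eclIsoOver`,
  `realize_term_val_over`, `mem_ecl_range_iff_of_eclIsoOver_snoc` (the closure is determined by
  isomorphisms of pointed closures — replacing the detour through the base-free language),
  `ExponentialRingEquiv.ofEclIsoOverEquiv`.
* Closed embeddings: `equivRangeOfClosedEmb`, `image_ecl_of_closedEmb`, `exists_lift_of_closedEmb`,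
  `ecl_range_id`, `ecl_range_comp_of_closedEmb`.
* The class `ZilberClosedClassOver P` of closed E-subfields (in `Type u`) of uncountable Zilber
  fields (in `Type u`) with base points onto `ecl(∅)`, `zilberClosedClassOver_of_isZilberField`,
  and the substructures `Language.eclIsoOver.eclSubstructure`.

Everything is proved; no named fact is introduced.

## References

* M. Bays, J. Kirby, Algebra & Number Theory 12 (2018) 493–549: Def. 6.1–6.3, Remark 6.6, §8,
  Thm 9.1.
* J. Kirby, J. Symbolic Logic 75 (2010) 551–564: Def. 1.1, Lemma 1.3, Prop. 3.5.
* L. Haykazyan, J. Symbolic Logic 81 (2016) 56–64: Def. 2, Thm 16.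
* J. Kirby, A. Macintyre, A. Onshuus, J. Inst. Math. Jussieu 11 (2012): §3.5.
-/

noncomputable section

open FirstOrder FirstOrder.Language Set Cardinal
open Literature.ModelTheory.ExponentialFields Literature.ModelTheory.Quasiminimal

universe u v w

namespace Literature.NumberTheory.Transcendental

namespace ZilberOverUniv

/-! ### Base points -/

/-- A **base point** of the exponential field `K` over the exponential field `P`: an embedding of
exponential rings `P → K` (in the class of closed subfields of Zilber fields, an isomorphism of `P`
onto the prime model `ecl^K(∅)`; Bays–Kirby 2018 §8: parameters for the base `F_base`).
[cite: BaysKirby2018ANT, §8 (the language L_{F_base})] -/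
class EclBasePoint (P : Type u) [Field P] [ExponentialRing P] (K : Type u) [Field K]
    [ExponentialRing K] where
  /-- the base embedding `ι_K : P → K` -/
  hom : ExponentialRingHom P K

/-- The base embedding `ι_K : P → K` of an exponential field with a base point. [folklore] -/
abbrev basePt (P : Type u) [Field P] [ExponentialRing P] (K : Type u) [Field K] [ExponentialRing K]
    [EclBasePoint P K] : ExponentialRingHom P K :=
  EclBasePoint.hom

variable {P : Type u} [Field P] [ExponentialRing P]

/-! ### The language -/

/-- A **pointed exponential field over `P`**: an exponential field `T` (in `Type u`) with an
`n`-tuple `t̄` and an embedding of exponential rings `κ : P → T`. These index the `n`-ary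
relation symbols of `Language.eclIsoOver P`. [folklore] -/
structure PointedEFieldOver (P : Type u) [Field P] [ExponentialRing P] (n : ℕ) : Type (u + 1) where
  /-- the field -/
  carrier : Type u
  /-- its field structure -/
  [instField : Field carrier]
  /-- its exponential -/
  [instExp : ExponentialRing carrier]
  /-- the distinguished tuple -/
  pt : Fin n → carrier
  /-- the base embedding -/
  base : @ExponentialRingHom P carrier _ _ _ instExp

/-- The field structure of a pointed exponential field over `P`. [folklore] -/
instance PointedEFieldOver.instFieldCarrier {P : Type u} [Field P] [ExponentialRing P] {n : ℕ}
    (T : PointedEFieldOver P n) : Field T.carrier := T.instField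

/-- The exponential of a pointed exponential field over `P`. [folklore] -/
instance PointedEFieldOver.instExpCarrier {P : Type u} [Field P] [ExponentialRing P] {n : ℕ}
    (T : PointedEFieldOver P n) : ExponentialRing T.carrier := T.instExp

/-- **The closure-isomorphism language over the base `P`**: function symbols `+, ·, -, 0, 1, exp`
and an `n`-ary relation symbol for every pointed exponential field `(T, t̄, κ)` over `P` — to be
read "`(ecl(x̄), x̄, ι_K) ≅ (T, t̄, κ)`". Quantifier-free types of finite tuples in this language are
Galois types over the base (Bays–Kirby 2018, Remark 6.6 for `L_{F_base}`).
[cite: BaysKirby2018ANT, Remark 6.6 and Def. 6.7] -/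
def Language.eclIsoOver (P : Type u) [Field P] [ExponentialRing P] : Language.{0, u + 1} :=
  { Functions := expRingFunc
    Relations := PointedEFieldOver P }

section Structure

variable {K : Type u} [Field K] [ExponentialRing K] [EclBasePoint P K]

/-- An exponential field with a base point is a structure for `Language.eclIsoOver P`: the function
symbols as in `Language.expRing`, and `R_{(T,t̄,κ)}(x̄)` iff some embedding of exponential rings
`T → K` has image `ecl(x̄)`, maps `t̄ ↦ x̄` and `κ ↦ ι_K`. [cite: BaysKirby2018ANT, Remark 6.6] -/
instance Language.eclIsoOver.instStructure : (Language.eclIsoOver.{u} P).Structure K where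
  funMap
  | .add, v => v 0 + v 1
  | .mul, v => v 0 * v 1
  | .neg, v => -v 0
  | .zero, _ => 0
  | .one, _ => 1
  | .exp, v => ExponentialRing.exp (v 0)
  RelMap := fun {n} (T : PointedEFieldOver P n) (x : Fin n → K) =>
    ∃ φ : ExponentialRingHom T.carrier K, Set.range φ = ecl (Set.range x) ∧ ⇑φ ∘ T.pt = x ∧
      ∀ p, φ (T.base p) = basePt P K p

namespace Language.eclIsoOver

/-- Interpretation of `+` (by `rfl`). [folklore] -/
@[simp] theorem funMap_add (v : Fin 2 → K) :
    Structure.funMap (L := Language.eclIsoOver P) expRingFunc.add v = v 0 + v 1 := rfl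

/-- Interpretation of `·` (by `rfl`). [folklore] -/
@[simp] theorem funMap_mul (v : Fin 2 → K) :
    Structure.funMap (L := Language.eclIsoOver P) expRingFunc.mul v = v 0 * v 1 := rfl

/-- Interpretation of `-` (by `rfl`). [folklore] -/
@[simp] theorem funMap_neg (v : Fin 1 → K) :
    Structure.funMap (L := Language.eclIsoOver P) expRingFunc.neg v = -v 0 := rfl

/-- Interpretation of `0` (by `rfl`). [folklore] -/
@[simp] theorem funMap_zero (v : Fin 0 → K) :
    Structure.funMap (L := Language.eclIsoOver P) expRingFunc.zero v = 0 := rfl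

/-- Interpretation of `1` (by `rfl`). [folklore] -/
@[simp] theorem funMap_one (v : Fin 0 → K) :
    Structure.funMap (L := Language.eclIsoOver P) expRingFunc.one v = 1 := rfl

/-- Interpretation of `exp` (by `rfl`). [folklore] -/
@[simp] theorem funMap_exp (v : Fin 1 → K) :
    Structure.funMap (L := Language.eclIsoOver P) expRingFunc.exp v = ExponentialRing.exp (v 0) :=
  rfl

/-- Interpretation of the relation symbol `R_{(T,t̄,κ)}` (by `Iff.rfl`). [folklore] -/
theorem relMap_iff {n : ℕ} (T : PointedEFieldOver P n) (x : Fin n → K) :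
    Structure.RelMap (L := Language.eclIsoOver P) T x ↔
      ∃ φ : ExponentialRingHom T.carrier K, Set.range φ = ecl (Set.range x) ∧ ⇑φ ∘ T.pt = x ∧
        ∀ p, φ (T.base p) = basePt P K p :=
  Iff.rfl

end Language.eclIsoOver

end Structure
/-! ### Isomorphisms of pointed closures over the base points -/

section EclIsoOver

variable {K : Type u} [Field K] [ExponentialRing K] {K' : Type u} [Field K'] [ExponentialRing K']

/-- **`EclIsoOver ι ι' u u'`: the pointed closures `(ecl^K(u), u)` and `(ecl^{K'}(u'), u')` are
isomorphic over the base points** — there is an embedding of exponential rings `ecl^K(u) → K'`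
with image `ecl^{K'}(u')`, `u ↦ u'`, which agrees with `ι'` on `ι(P)` (wherever `ι(P)` meets
`ecl(u)`; in the application `ι(P) = ecl(∅) ⊆ ecl(u)`). The two-field form of "`u` and `u'` are
conjugate under `Aut(M / ecl ∅)`" (Bays–Kirby 2018, Remark 6.6, Galois types over the base).
[cite: BaysKirby2018ANT, Remark 6.6] [cite: Kirby2010QMEC, Prop. 3.5] -/
def EclIsoOver (ι : ExponentialRingHom P K) (ι' : ExponentialRingHom P K') {k : ℕ} (u : Fin k → K)
    (u' : Fin k → K') : Prop :=
  ∃ ψ : ExponentialRingHom (Khovanskii.eclSubfield (Set.range u)) K',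
    Set.range ψ = ecl (Set.range u') ∧ (∀ i, ψ ⟨u i, subset_ecl _ (Set.mem_range_self i)⟩ = u' i) ∧
      ∀ (p : P) (h : ι p ∈ ecl (Set.range u)), ψ ⟨ι p, h⟩ = ι' p

/-- Unfolding lemma for `EclIsoOver`. [folklore] -/
theorem eclIsoOver_iff {ι : ExponentialRingHom P K} {ι' : ExponentialRingHom P K'} {k : ℕ}
    {u : Fin k → K} {u' : Fin k → K'} :
    EclIsoOver ι ι' u u' ↔ ∃ ψ : ExponentialRingHom (Khovanskii.eclSubfield (Set.range u)) K',
      Set.range ψ = ecl (Set.range u') ∧ (∀ i, ψ ⟨u i, subset_ecl _ (Set.mem_range_self i)⟩ = u' i) ∧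
        ∀ (p : P) (h : ι p ∈ ecl (Set.range u)), ψ ⟨ι p, h⟩ = ι' p :=
  Iff.rfl

/-- The base embedding, co-restricted to an E-subfield `ecl S` containing its image. [folklore] -/
def ExponentialRingHom.codRestrictEcl (ι : ExponentialRingHom P K) (S : Set K)
    (h : ∀ p, ι p ∈ ecl S) : ExponentialRingHom P (Khovanskii.eclSubfield S) :=
  { ι.toRingHom.codRestrict (Khovanskii.eclSubfield S) h with
    map_exp' := fun p => Subtype.ext (by
      change (ι (ExponentialRing.exp p) : K) = ExponentialRing.exp (ι p : K)
      exact ι.map_exp p) }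

/-- `codRestrictEcl` on coordinates. [folklore] -/
@[simp] theorem ExponentialRingHom.coe_codRestrictEcl_apply (ι : ExponentialRingHom P K) (S : Set K)
    (h : ∀ p, ι p ∈ ecl S) (p : P) :
    ((ExponentialRingHom.codRestrictEcl ι S h p : Khovanskii.eclSubfield S) : K) = ι p :=
  rfl

end EclIsoOver

/-! ### Embeddings of closed E-subfields -/

section EclEquiv

variable {K : Type u} [Field K] [ExponentialRing K] {K' : Type u} [Field K'] [ExponentialRing K']

/-- An embedding of exponential rings out of `ecl(S) ≤ K` whose image is `ecl(S') ⊆ K'`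
co-restricts to an isomorphism of exponential fields `ecl(S) ≅ ecl(S')`. [folklore] -/
def eclEquivOfEHom {S : Set K} {S' : Set K'}
    (φ : ExponentialRingHom (Khovanskii.eclSubfield S) K') (hφ : Set.range φ = ecl S') :
    ExponentialRingEquiv (Khovanskii.eclSubfield S) (Khovanskii.eclSubfield S') :=
  have hmem : ∀ z : Khovanskii.eclSubfield S, φ z ∈ Khovanskii.eclSubfield S' := fun z => by
    change φ z ∈ ecl S'
    rw [← hφ]; exact ⟨z, rfl⟩
  have hbij : Function.Bijective (φ.toRingHom.codRestrict (Khovanskii.eclSubfield S') hmem) := by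
    refine ⟨fun z w h => φ.toRingHom.injective (congr_arg Subtype.val h :), fun w => ?_⟩
    have : (w : K') ∈ Set.range φ := by rw [hφ]; exact w.2
    obtain ⟨z, hz⟩ := this
    exact ⟨z, Subtype.ext hz⟩
  { RingEquiv.ofBijective (φ.toRingHom.codRestrict (Khovanskii.eclSubfield S') hmem) hbij with
    map_exp' := fun z => Subtype.ext (by
      change (φ (ExponentialRing.exp z) : K') = ExponentialRing.exp (φ z : K')
      exact φ.map_exp z) }

/-- `eclEquivOfEHom φ hφ` is `φ` on coordinates. [folklore] -/
@[simp] theorem coe_eclEquivOfEHom_apply {S : Set K} {S' : Set K'}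
    (φ : ExponentialRingHom (Khovanskii.eclSubfield S) K') (hφ : Set.range φ = ecl S')
    (z : Khovanskii.eclSubfield S) : ((eclEquivOfEHom φ hφ z : Khovanskii.eclSubfield S') : K') = φ z :=
  rfl

/-- **`ecl` along an embedding with `ecl`-closed image**: for `φ : ecl(S) → K'` with image
`ecl(S')` and a tuple `u` from `ecl(S)`, `ecl^{K'}(φ u) = φ(ecl^{ecl S}(u))` — `ecl` is computed
inside `ecl`-closed E-subfields (`Khovanskii.eclSubfield.image_ecl`) and is transported by
isomorphisms of exponential fields (`Khovanskii.image_ecl_equiv`). [cite: Kirby2010QMEC, Lemma 1.3] -/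
theorem ecl_range_comp_eHom {S : Set K} {S' : Set K'}
    (φ : ExponentialRingHom (Khovanskii.eclSubfield S) K') (hφ : Set.range φ = ecl S')
    {ι : Type*} (u : ι → Khovanskii.eclSubfield S) :
    ecl (Set.range (⇑φ ∘ u)) = φ '' ecl (Set.range u) := by
  have e1 : ⇑φ ∘ u = Subtype.val ∘ (⇑(eclEquivOfEHom φ hφ) ∘ u) := funext fun i => rfl
  have e2 : (⇑φ : Khovanskii.eclSubfield S → K') = Subtype.val ∘ ⇑(eclEquivOfEHom φ hφ) :=
    funext fun z => rfl
  rw [e1, Set.range_comp Subtype.val, ← Khovanskii.eclSubfield.image_ecl, Set.range_comp,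
    ← Khovanskii.image_ecl_equiv, e2, Set.image_comp]

/-- `ecl` of a tuple from `ecl(S)`, computed in `K`, is the image of its `ecl` computed in the
E-subfield `ecl(S)`. [cite: Kirby2010QMEC, Lemma 1.3] -/
theorem ecl_range_comp_val {S : Set K} {ι : Type*} (u : ι → Khovanskii.eclSubfield S) :
    ecl (Set.range (Subtype.val ∘ u)) = Subtype.val '' ecl (Set.range u) := by
  rw [Set.range_comp, Khovanskii.eclSubfield.image_ecl]

end EclEquiv
/-! ### Quantifier-free types over the base are isomorphism types of pointed closures over the base -/

section Dictionary


/-- The pointed exponential field `(ecl(x̄), x̄, ι_K)` over `P` of a tuple `x̄` from an exponential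
field `K` in `Type u` whose base point lands in `ecl(∅)`. [cite: Kirby2010, Lemma 3.3] -/
def PointedEFieldOver.self {K : Type u} [Field K] [ExponentialRing K] [EclBasePoint P K]
    (hι : ∀ p, basePt P K p ∈ ecl (∅ : Set K)) {n : ℕ} (x : Fin n → K) : PointedEFieldOver P n where
  carrier := Khovanskii.eclSubfield (Set.range x)
  pt i := ⟨x i, subset_ecl _ (Set.mem_range_self i)⟩
  base := ExponentialRingHom.codRestrictEcl (basePt P K) (Set.range x)
    fun p => ecl_mono (Set.empty_subset _) (hι p)

/-- Every tuple satisfies its own relation symbol: `R_{(ecl(x̄), x̄, ι_K)}(x̄)`. [folklore] -/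
theorem relMap_self_over {K : Type u} [Field K] [ExponentialRing K] [EclBasePoint P K]
    (hι : ∀ p, basePt P K p ∈ ecl (∅ : Set K)) {n : ℕ} (x : Fin n → K) :
    Structure.RelMap (L := Language.eclIsoOver P) (PointedEFieldOver.self hι x) x := by
  refine ⟨Khovanskii.eclSubfield.eHom (Set.range x), ?_, funext fun i => rfl, fun p => ?_⟩
  swap
  · rfl
  ext a
  simp only [Set.mem_range]
  constructor
  · rintro ⟨b, rfl⟩; exact b.2
  · intro ha; exact ⟨⟨a, ha⟩, rfl⟩

/-- **Equal quantifier-free `Language.eclIsoOver P`-types give isomorphic pointed closures over the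
base points** (apply type-equality to the atomic formula `R_{(ecl(x̄), x̄, ι_K)}(v̄)`).
[cite: Kirby2010QMEC, Prop. 3.5] [cite: BaysKirby2018ANT, Remark 6.6] -/
theorem eclIsoOver_of_eqQFType₂ {K : Type u} [Field K] [ExponentialRing K] [EclBasePoint P K]
    {K' : Type u} [Field K'] [ExponentialRing K'] [EclBasePoint P K']
    (hι : ∀ p, basePt P K p ∈ ecl (∅ : Set K)) {n : ℕ} {x : Fin n → K} {x' : Fin n → K'}
    (h : (Language.eclIsoOver P).EqQFType₂ x x') : EclIsoOver (basePt P K) (basePt P K') x x' := by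
  have hat : BoundedFormula.IsAtomic
      (Relations.formula (L := Language.eclIsoOver P) (PointedEFieldOver.self hι x) fun i => var i) :=
    BoundedFormula.IsAtomic.rel _ _
  have key := (h _ hat).1 (by
    rw [Formula.realize_rel]
    simpa using relMap_self_over hι x)
  rw [Formula.realize_rel] at key
  simp only [Term.realize_var] at key
  obtain ⟨φ, hφ, hφx, hφb⟩ := (Language.eclIsoOver.relMap_iff _ _).1 key
  exact ⟨φ, hφ, fun i => congr_fun hφx i, fun p _ => hφb p⟩

/-- **Morphisms of exponential rings commute with the evaluation of `Language.eclIsoOver P`-terms**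
(the terms are the exponential-ring terms). [folklore] -/
theorem realize_term_eHom_over {R S : Type u} [Field R] [ExponentialRing R] [EclBasePoint P R]
    [Field S] [ExponentialRing S] [EclBasePoint P S]
    (ψ : ExponentialRingHom R S) {α : Type*} (t : (Language.eclIsoOver P).Term α) (v : α → R) :
    ψ (t.realize v) = t.realize (⇑ψ ∘ v) := by
  induction t with
  | var a => rfl
  | func f ts ih =>
    cases f with
    | add =>
      simp only [Term.realize, Language.eclIsoOver.funMap_add]
      rw [map_add, ih 0, ih 1]
    | mul =>
      simp only [Term.realize, Language.eclIsoOver.funMap_mul]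
      rw [map_mul, ih 0, ih 1]
    | neg =>
      simp only [Term.realize, Language.eclIsoOver.funMap_neg]
      rw [map_neg, ih 0]
    | zero =>
      simp only [Term.realize, Language.eclIsoOver.funMap_zero]
      exact map_zero ψ
    | one =>
      simp only [Term.realize, Language.eclIsoOver.funMap_one]
      exact map_one ψ
    | exp =>
      simp only [Term.realize, Language.eclIsoOver.funMap_exp]
      rw [ExponentialRingHom.map_exp, ih 0]

section Converse

variable {K : Type u} [Field K] [ExponentialRing K] [EclBasePoint P K]
  {K' : Type u} [Field K'] [ExponentialRing K'] [EclBasePoint P K']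

/-- **The relation symbols of `Language.eclIsoOver P` are invariant under embeddings of
`ecl`-closed exponential subfields which respect the base points**: for `φ : ecl(S) → K'` with
image `ecl(S')` and `φ ∘ ι_K = ι_{K'}`, and a tuple `u` from `ecl(S)`, `R_{(T,t̄,κ)}(u)` holds in
`K` iff `R_{(T,t̄,κ)}(φ u)` holds in `K'`. (Proof of `relMap_comp_iff_of_eHom`, keeping track of
the base.) [cite: Kirby2010QMEC, Lemma 1.3 and Prop. 3.5] -/
theorem relMap_comp_iff_of_eHom_over {S : Set K} {S' : Set K'}
    (φ : ExponentialRingHom (Khovanskii.eclSubfield S) K') (hφ : Set.range φ = ecl S')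
    (hιS : ∀ p, basePt P K p ∈ ecl S) (hφb : ∀ p, φ ⟨basePt P K p, hιS p⟩ = basePt P K' p)
    {k : ℕ} (T : PointedEFieldOver P k) (u : Fin k → Khovanskii.eclSubfield S) :
    Structure.RelMap (L := Language.eclIsoOver P) T (Subtype.val ∘ u) ↔
      Structure.RelMap (L := Language.eclIsoOver P) T (⇑φ ∘ u) := by
  have hφinj : Function.Injective φ := φ.toRingHom.injective
  have hKF := ecl_range_comp_val u
  have hK'F := ecl_range_comp_eHom φ hφ u
  rw [Language.eclIsoOver.relMap_iff, Language.eclIsoOver.relMap_iff]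
  constructor
  · rintro ⟨ψ, hψ, hψt, hψb⟩
    -- `ψ` lands in `ecl S`
    have hψF : ∀ z, ψ z ∈ Khovanskii.eclSubfield S := fun z => by
      have : ψ z ∈ ecl (Set.range (Subtype.val ∘ u)) := by rw [← hψ]; exact ⟨z, rfl⟩
      rw [hKF] at this
      obtain ⟨c, -, hc⟩ := this
      rw [← hc]; exact c.2
    let ψ₀ : ExponentialRingHom T.carrier (Khovanskii.eclSubfield S) :=
      { ψ.toRingHom.codRestrict (Khovanskii.eclSubfield S) hψF with
        map_exp' := fun z => Subtype.ext (ψ.map_exp z) }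
    have hψ₀ : ∀ z, ((ψ₀ z : Khovanskii.eclSubfield S) : K) = ψ z := fun z => rfl
    have hrange : Set.range ψ₀ = ecl (Set.range u) := by
      ext c
      constructor
      · rintro ⟨z, rfl⟩
        have : (ψ₀ z : K) ∈ Subtype.val '' ecl (Set.range u) := by
          rw [← hKF, hψ₀, ← hψ]; exact ⟨z, rfl⟩
        obtain ⟨c, hc, hcz⟩ := this
        rwa [← Subtype.ext hcz]
      · intro hc
        have : (c : K) ∈ ecl (Set.range (Subtype.val ∘ u)) := by rw [hKF]; exact ⟨c, hc, rfl⟩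
        rw [← hψ] at this
        obtain ⟨z, hz⟩ := this
        exact ⟨z, Subtype.ext (by rw [hψ₀, hz])⟩
    refine ⟨φ.comp ψ₀, ?_, ?_, fun p => ?_⟩
    · rw [hK'F, ← hrange, ← Set.range_comp]; rfl
    · funext i
      have hi : ψ (T.pt i) = (u i : K) := congr_fun hψt i
      have : ψ₀ (T.pt i) = u i := Subtype.ext (by rw [hψ₀, hi])
      change φ (ψ₀ (T.pt i)) = φ (u i)
      rw [this]
    · have : ψ₀ (T.base p) = ⟨basePt P K p, hιS p⟩ := Subtype.ext (by rw [hψ₀]; exact hψb p)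
      change φ (ψ₀ (T.base p)) = basePt P K' p
      rw [this, hφb]
  · rintro ⟨ψ', hψ', hψ't, hψ'b⟩
    -- `ψ'` lands in `φ(ecl S)`; pull it back along `φ`
    have hψ'φ : ∀ z, ∃ a : Khovanskii.eclSubfield S, φ a = ψ' z := fun z => by
      have : ψ' z ∈ ecl (Set.range (⇑φ ∘ u)) := by rw [← hψ']; exact ⟨z, rfl⟩
      rw [hK'F] at this
      obtain ⟨a, -, ha⟩ := this
      exact ⟨a, ha⟩
    choose ρ hρ using hψ'φ
    have hρ1 : ρ 1 = 1 := hφinj (by rw [hρ, map_one, map_one])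
    have hρ0 : ρ 0 = 0 := hφinj (by rw [hρ, map_zero, map_zero])
    have hρa : ∀ z w, ρ (z + w) = ρ z + ρ w := fun z w =>
      hφinj (by rw [map_add, hρ, hρ, hρ, map_add])
    have hρm : ∀ z w, ρ (z * w) = ρ z * ρ w := fun z w =>
      hφinj (by rw [map_mul, hρ, hρ, hρ, map_mul])
    have hρe : ∀ z, ρ (ExponentialRing.exp z) = ExponentialRing.exp (ρ z) := fun z =>
      hφinj (by rw [hρ, φ.map_exp, hρ, ψ'.map_exp])
    let ρ₀ : ExponentialRingHom T.carrier (Khovanskii.eclSubfield S) :=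
      { toFun := ρ
        map_one' := hρ1
        map_mul' := hρm
        map_zero' := hρ0
        map_add' := hρa
        map_exp' := hρe }
    have hρ₀ : ∀ z, ρ₀ z = ρ z := fun z => rfl
    have hrange : Set.range ρ₀ = ecl (Set.range u) := by
      ext c
      constructor
      · rintro ⟨z, rfl⟩
        have : φ (ρ₀ z) ∈ φ '' ecl (Set.range u) := by rw [← hK'F, hρ₀, hρ, ← hψ']; exact ⟨z, rfl⟩
        obtain ⟨c, hc, hcz⟩ := this
        rwa [← hφinj hcz]
      · intro hc
        have : φ c ∈ ecl (Set.range (⇑φ ∘ u)) := by rw [hK'F]; exact ⟨c, hc, rfl⟩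
        rw [← hψ'] at this
        obtain ⟨z, hz⟩ := this
        exact ⟨z, by rw [hρ₀]; exact hφinj (by rw [hρ, hz])⟩
    refine ⟨(Khovanskii.eclSubfield.eHom S).comp ρ₀, ?_, ?_, fun p => ?_⟩
    · rw [hKF, ← hrange, ← Set.range_comp]; rfl
    · funext i
      have hi : ψ' (T.pt i) = φ (u i) := congr_fun hψ't i
      have : ρ₀ (T.pt i) = u i := by rw [hρ₀]; exact hφinj (by rw [hρ, hi])
      change ((ρ₀ (T.pt i) : Khovanskii.eclSubfield S) : K) = u i
      rw [this]
    · have : ρ₀ (T.base p) = ⟨basePt P K p, hιS p⟩ := by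
        rw [hρ₀]; exact hφinj (by rw [hρ, hψ'b p, hφb p])
      change ((ρ₀ (T.base p) : Khovanskii.eclSubfield S) : K) = basePt P K p
      rw [this]

/-- **Isomorphic pointed closures over the base points give equal quantifier-free
`Language.eclIsoOver P`-types**: if `φ : ecl^K(x̄) → K'` has image `ecl^{K'}(x̄')`, maps `x̄ ↦ x̄'`
and `ι_K ↦ ι_{K'}`, then `qftp(x̄) = qftp(x̄')` (terms are transported by `φ`, relation symbols
are invariant by `relMap_comp_iff_of_eHom_over`). [cite: Kirby2010QMEC, Prop. 3.5]
[cite: BaysKirby2018ANT, Remark 6.6] -/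
theorem eqQFType₂_of_eclIsoOver (hι : ∀ p, basePt P K p ∈ ecl (∅ : Set K)) {n : ℕ} {x : Fin n → K}
    {x' : Fin n → K'} (h : EclIsoOver (basePt P K) (basePt P K') x x') :
    (Language.eclIsoOver P).EqQFType₂ x x' := by
  obtain ⟨φ, hφ, hφx, hφb⟩ := h
  have hιS : ∀ p, basePt P K p ∈ ecl (Set.range x) := fun p => ecl_mono (Set.empty_subset _) (hι p)
  set F := Khovanskii.eclSubfield (Set.range x) with hF
  letI : EclBasePoint P F := ⟨ExponentialRingHom.codRestrictEcl (basePt P K) (Set.range x) hιS⟩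
  let x₀ : Fin n → F := fun i => ⟨x i, subset_ecl _ (Set.mem_range_self i)⟩
  have hx : x = Subtype.val ∘ x₀ := funext fun i => rfl
  have hx' : x' = ⇑φ ∘ x₀ := funext fun i => (hφx i).symm
  have hv : (Sum.elim x (default : Fin 0 → K)) =
      ⇑(Khovanskii.eclSubfield.eHom (Set.range x)) ∘ Sum.elim x₀ (default : Fin 0 → F) := by
    funext s; rcases s with i | j
    · rfl
    · exact j.elim0
  have hv' : (Sum.elim x' (default : Fin 0 → K')) = ⇑φ ∘ Sum.elim x₀ (default : Fin 0 → F) := by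
    funext s; rcases s with i | j
    · simp [hx']
    · exact j.elim0
  intro ψf hψf
  change BoundedFormula.Realize ψf x default ↔ BoundedFormula.Realize ψf x' default
  cases hψf with
  | equal t₁ t₂ =>
    simp only [BoundedFormula.realize_bdEqual]
    rw [hv, hv', ← realize_term_eHom_over, ← realize_term_eHom_over, ← realize_term_eHom_over,
      ← realize_term_eHom_over]
    have hφinj : Function.Injective φ := φ.toRingHom.injective
    simp only [Khovanskii.eclSubfield.eHom_apply]
    rw [Subtype.val_injective.eq_iff, hφinj.eq_iff]
  | rel R ts =>
    simp only [BoundedFormula.realize_rel]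
    rw [hv, hv']
    have e1 : (fun i => (ts i).realize (⇑(Khovanskii.eclSubfield.eHom (Set.range x)) ∘
        Sum.elim x₀ default)) = Subtype.val ∘ fun i => (ts i).realize (Sum.elim x₀ default) := by
      funext i
      simp only [Function.comp_apply, ← realize_term_eHom_over, Khovanskii.eclSubfield.eHom_apply]
    have e2 : (fun i => (ts i).realize (⇑φ ∘ Sum.elim x₀ default)) =
        ⇑φ ∘ fun i => (ts i).realize (Sum.elim x₀ default) := by
      funext i
      simp only [Function.comp_apply, ← realize_term_eHom_over]
    rw [e1, e2]
    exact relMap_comp_iff_of_eHom_over φ hφ hιS (fun p => hφb p (hιS p)) R _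

/-- **The dictionary**: in `Language.eclIsoOver P`, two tuples (from fields whose base points land
in `ecl(∅)`) have the same quantifier-free type iff their pointed closures are isomorphic over the
base points — Galois types over the base (Bays–Kirby 2018, Remark 6.6; Kirby 2010, Prop. 3.5).
[cite: BaysKirby2018ANT, Remark 6.6] [cite: Kirby2010QMEC, Prop. 3.5] -/
theorem eqQFType₂_iff_eclIsoOver (hι : ∀ p, basePt P K p ∈ ecl (∅ : Set K)) {n : ℕ} {x : Fin n → K}
    {x' : Fin n → K'} :
    (Language.eclIsoOver P).EqQFType₂ x x' ↔ EclIsoOver (basePt P K) (basePt P K') x x' :=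
  ⟨eclIsoOver_of_eqQFType₂ hι, eqQFType₂_of_eclIsoOver hι⟩

end Converse

/-! ### The base-point structure on an E-subfield `ecl S` -/

/-- In the E-subfield `ecl S` of a field with a base point landing in `ecl S`, the realisation of
`Language.eclIsoOver P`-terms commutes with the inclusion (for any base point on `ecl S`).
[folklore] -/
theorem realize_term_val_over {K : Type u} [Field K] [ExponentialRing K] [EclBasePoint P K]
    {S : Set K} [EclBasePoint P (Khovanskii.eclSubfield S)] {α : Type*}
    (t : (Language.eclIsoOver P).Term α) (v : α → Khovanskii.eclSubfield S) :
    ((t.realize v : Khovanskii.eclSubfield S) : K) = t.realize (Subtype.val ∘ v) :=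
  realize_term_eHom_over (Khovanskii.eclSubfield.eHom S) t v

end Dictionary

/-! ### The closure is determined by isomorphisms of pointed closures -/

section ClosureDetermined

variable {K : Type u} [Field K] [ExponentialRing K] {K' : Type u} [Field K'] [ExponentialRing K']
  {ι : ExponentialRingHom P K} {ι' : ExponentialRingHom P K'}

/-- **Isomorphisms of pointed closures carry `ecl`-dependence** (Kirby 2010, axiom I.3 / Lemma 1.3
for exponential fields, stated with `EclIsoOver` in place of equality of quantifier-free types):
if `(b, y) ↦ (b', y')` is an isomorphism of pointed closures then `y ∈ ecl (range b)` iff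
`y' ∈ ecl (range b')` (the isomorphism maps `ecl(b)` onto `ecl(b')`, `ecl_range_comp_eHom`).
[cite: Kirby2010QMEC, Lemma 1.3] -/
theorem mem_ecl_range_iff_of_eclIsoOver_snoc {n : ℕ} {b : Fin n → K} {b' : Fin n → K'} {y : K}
    {y' : K'} (h : EclIsoOver ι ι' (Fin.snoc b y : Fin (n + 1) → K) (Fin.snoc b' y')) :
    y ∈ ecl (Set.range b) ↔ y' ∈ ecl (Set.range b') := by
  set t : Fin (n + 1) → K := Fin.snoc b y with ht
  set t' : Fin (n + 1) → K' := Fin.snoc b' y' with ht'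
  obtain ⟨φ, hφ, hφt, -⟩ := h
  have hφinj : Function.Injective φ := φ.toRingHom.injective
  -- the tuple `b` and the point `y` inside the E-subfield `ecl(t)`
  have hbt : ∀ i, b i ∈ ecl (Set.range t) := fun i =>
    subset_ecl _ ⟨Fin.castSucc i, by simp [ht]⟩
  have hyt : y ∈ ecl (Set.range t) := subset_ecl _ ⟨Fin.last n, by simp [ht]⟩
  let b₀ : Fin n → Khovanskii.eclSubfield (Set.range t) := fun i => ⟨b i, hbt i⟩
  let y₀ : Khovanskii.eclSubfield (Set.range t) := ⟨y, hyt⟩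
  have hb : Subtype.val ∘ b₀ = b := funext fun i => rfl
  have hφb : ⇑φ ∘ b₀ = b' := funext fun i => by
    have := hφt (Fin.castSucc i)
    simp only [ht, ht', Fin.snoc_castSucc] at this
    exact this
  have hφy : φ y₀ = y' := by
    have := hφt (Fin.last n)
    simp only [ht, ht', Fin.snoc_last] at this
    exact this
  have hK := ecl_range_comp_val b₀
  have hK' := ecl_range_comp_eHom φ hφ b₀
  rw [hb] at hK
  rw [hφb] at hK'
  constructor
  · intro hy
    rw [hK] at hy
    obtain ⟨c, hc, hcy⟩ := hy
    have : c = y₀ := Subtype.ext hcy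
    subst this
    rw [hK', ← hφy]
    exact ⟨y₀, hc, rfl⟩
  · intro hy'
    rw [hK', ← hφy] at hy'
    obtain ⟨c, hc, hcy⟩ := hy'
    have : c = y₀ := hφinj hcy
    subst this
    rw [hK]
    exact ⟨y₀, hc, rfl⟩

end ClosureDetermined
/-! ### Isomorphisms in the language are isomorphisms of exponential fields -/

section Equiv

variable {K K' : Type u} [Field K] [ExponentialRing K] [EclBasePoint P K] [Field K'] [ExponentialRing K']
  [EclBasePoint P K']

/-- **A `Language.eclIsoOver P`-isomorphism is an isomorphism of exponential rings** (the language
has the function symbols `+`, `·`, `exp`). [folklore] -/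
def ExponentialRingEquiv.ofEclIsoOverEquiv (e : K ≃[Language.eclIsoOver P] K') :
    ExponentialRingEquiv K K' where
  toEquiv := e.toEquiv
  map_mul' a b := by
    change e (a * b) = e a * e b
    simpa using e.map_fun expRingFunc.mul ![a, b]
  map_add' a b := by
    change e (a + b) = e a + e b
    simpa using e.map_fun expRingFunc.add ![a, b]
  map_exp' a := by
    change e (ExponentialRing.exp a) = ExponentialRing.exp (e a)
    simpa using e.map_fun expRingFunc.exp ![a]

/-- `ofEclIsoOverEquiv e` is `e` as a function. [folklore] -/
@[simp] theorem ExponentialRingEquiv.ofEclIsoOverEquiv_apply (e : K ≃[Language.eclIsoOver P] K')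
    (a : K) : ExponentialRingEquiv.ofEclIsoOverEquiv e a = e a := rfl

end Equiv

/-! ### Closed embeddings of exponential fields -/

section ClosedEmb

variable {R : Type v} [Field R] [ExponentialRing R] {K : Type u} [Field K] [ExponentialRing K]

/-- **An embedding of exponential rings with `ecl`-closed image co-restricts to an isomorphism
onto the E-subfield `ecl(range φ) = range φ`.** [folklore] -/
def equivRangeOfClosedEmb (φ : ExponentialRingHom R K) (hφ : ecl (Set.range φ) = Set.range φ) :
    ExponentialRingEquiv R (Khovanskii.eclSubfield (Set.range φ)) :=
  have hmem : ∀ z : R, φ z ∈ Khovanskii.eclSubfield (Set.range φ) := fun z => by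
    change φ z ∈ ecl (Set.range φ)
    rw [hφ]; exact ⟨z, rfl⟩
  have hbij : Function.Bijective (φ.toRingHom.codRestrict (Khovanskii.eclSubfield (Set.range φ)) hmem) := by
    refine ⟨fun z w h => φ.toRingHom.injective (congr_arg Subtype.val h :), fun w => ?_⟩
    have hw : (w : K) ∈ ecl (Set.range φ) := w.2
    rw [hφ] at hw
    obtain ⟨z, hz⟩ := hw
    exact ⟨z, Subtype.ext hz⟩
  { RingEquiv.ofBijective (φ.toRingHom.codRestrict (Khovanskii.eclSubfield (Set.range φ)) hmem) hbij with
    map_exp' := fun z => Subtype.ext (by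
      change (φ (ExponentialRing.exp z) : K) = ExponentialRing.exp (φ z : K)
      exact φ.map_exp z) }

/-- `equivRangeOfClosedEmb` is `φ` on coordinates. [folklore] -/
@[simp] theorem coe_equivRangeOfClosedEmb_apply (φ : ExponentialRingHom R K)
    (hφ : ecl (Set.range φ) = Set.range φ) (z : R) :
    ((equivRangeOfClosedEmb φ hφ z : Khovanskii.eclSubfield (Set.range φ)) : K) = φ z := rfl

/-- **Closed embeddings carry `ecl` onto `ecl`** (Kirby 2010 (QMEC), Lemma 1.3; Haykazyan 2016,
Prop. 4: `cl_H(X) = cl_{H'}(X)` for `H` closed in `H'`): if `φ : R → K` is an embedding of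
exponential rings with `ecl`-closed image then `φ '' ecl C = ecl (φ '' C)`.
[cite: Kirby2010QMEC, Lemma 1.3] -/
theorem image_ecl_of_closedEmb (φ : ExponentialRingHom R K) (hφ : ecl (Set.range φ) = Set.range φ)
    (C : Set R) : φ '' ecl C = ecl (φ '' C) := by
  have e1 : (⇑φ : R → K) = Subtype.val ∘ ⇑(equivRangeOfClosedEmb φ hφ) := funext fun z => rfl
  rw [e1, Set.image_comp, Khovanskii.image_ecl_equiv, Khovanskii.eclSubfield.image_ecl,
    ← Set.image_comp]

/-- A closed embedding pulls back an embedding of exponential rings landing in its image.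
[folklore] -/
theorem exists_lift_of_closedEmb (φ : ExponentialRingHom R K) (hφ : ecl (Set.range φ) = Set.range φ)
    {T : Type w} [Field T] [ExponentialRing T] (ψ' : ExponentialRingHom T K)
    (hψ' : Set.range ψ' ⊆ Set.range φ) :
    ∃ ψ : ExponentialRingHom T R, ∀ t, φ (ψ t) = ψ' t := by
  have hmem : ∀ t, ψ' t ∈ Khovanskii.eclSubfield (Set.range φ) := fun t => by
    change ψ' t ∈ ecl (Set.range φ)
    rw [hφ]; exact hψ' ⟨t, rfl⟩
  let ψ₀ : ExponentialRingHom T (Khovanskii.eclSubfield (Set.range φ)) :=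
    { toRingHom := ψ'.toRingHom.codRestrict _ hmem
      map_exp' := fun t => Subtype.ext (by
        change (ψ' (ExponentialRing.exp t) : K) = ExponentialRing.exp (ψ' t : K)
        exact ψ'.map_exp t) }
  let e := equivRangeOfClosedEmb φ hφ
  refine ⟨e.symm.toExponentialRingHom.comp ψ₀, fun t => ?_⟩
  change φ (e.symm (ψ₀ t)) = ψ' t
  have : ((e (e.symm (ψ₀ t)) : Khovanskii.eclSubfield (Set.range φ)) : K) = ψ' t := by
    rw [ExponentialRingEquiv.apply_symm_apply]; rfl
  rwa [coe_equivRangeOfClosedEmb_apply] at this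

/-- The identity of an exponential field is a closed embedding iff… it always is: `ecl ⊤ = ⊤`.
[folklore] -/
theorem ecl_range_id : ecl (Set.range (ExponentialRingHom.id R)) = Set.range (ExponentialRingHom.id R) := by
  have : Set.range (ExponentialRingHom.id R) = Set.univ := Set.eq_univ_of_forall fun z => ⟨z, rfl⟩
  rw [this]
  exact Set.eq_univ_of_univ_subset (subset_ecl _)

/-- Compositions of closed embeddings are closed embeddings. [folklore] -/
theorem ecl_range_comp_of_closedEmb {S : Type w} [Field S] [ExponentialRing S]
    (ψ : ExponentialRingHom S R) (hψ : ecl (Set.range ψ) = Set.range ψ)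
    (φ : ExponentialRingHom R K) (hφ : ecl (Set.range φ) = Set.range φ) :
    ecl (Set.range (φ.comp ψ)) = Set.range (φ.comp ψ) := by
  change ecl (Set.range (⇑φ ∘ ⇑ψ)) = Set.range (⇑φ ∘ ⇑ψ)
  rw [Set.range_comp, ← image_ecl_of_closedEmb φ hφ, hψ]

end ClosedEmb

section TheClass


/-! ### The class: closed E-subfields of uncountable Zilber fields, with base points -/

variable (P) in
/-- **The class of closed E-subfields of uncountable Zilber fields, over the base `P`** (Bays–Kirby
2018, Def. 6.3 and §8; Kirby 2010, axiom I.2; Bays–Kirby 2013, §2.4): a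
`Language.eclIsoOver P`-structure-with-closure `⟨H, cl⟩` (with `H : Type u`) is a member iff it is
the canonical structure of an exponential field `H` of characteristic zero with a base point
`ι_H : P → H` whose image is `ecl^H(∅)`, with `cl = ecl`, admitting an embedding of exponential
rings into some uncountable Zilber field (in `Type u`) with `ecl`-closed image.
[cite: BaysKirby2018ANT, Def. 6.3 and §8] [cite: Kirby2010QMEC, Def. 1.1 (axiom I.2)] -/
def ZilberClosedClassOver : ∀ (H : Type u) [(Language.eclIsoOver.{u} P).Structure H], (Set H → Set H) → Prop :=
  fun H inst cl => ∃ (iF : Field H) (_ : CharZero H) (iE : ExponentialRing H)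
    (iB : @EclBasePoint P _ _ H iF iE),
    @Language.eclIsoOver.instStructure P _ _ H iF iE iB = inst ∧ cl = @ecl H iF iE ∧
    Set.range (@basePt P _ _ H iF iE iB) = @ecl H iF iE ∅ ∧
    ∃ (K : Type u) (iFK : Field K) (_ : CharZero K) (iEK : ExponentialRing K) (_ : IsZilberField K)
      (_ : ℵ₀ < #K) (φ : @ExponentialRingHom H K _ _ iE iEK),
        @ecl K iFK iEK (Set.range φ) = Set.range φ

/-- An uncountable Zilber field (in `Type u`) with a base point onto `ecl(∅)`, with its canonical
structure and `ecl`, is a member. [folklore] -/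
theorem zilberClosedClassOver_of_isZilberField {K : Type u} [Field K] [CharZero K] [ExponentialRing K]
    [EclBasePoint P K] (hK : IsZilberField K) (hKu : ℵ₀ < #K)
    (hι : Set.range (basePt P K) = ecl (∅ : Set K)) : ZilberClosedClassOver P K ecl :=
  ⟨_, ‹_›, _, ‹_›, rfl, rfl, hι, K, _, ‹_›, _, hK, hKu, ExponentialRingHom.id K, ecl_range_id⟩


end TheClass

/-! ### Axiom (3ii): closed subsets are members -/

section ClosedSubsets

variable {K : Type u} [Field K] [ExponentialRing K] [EclBasePoint P K]

/-- The `ecl`-closed E-subfield `ecl X ≤ K` as a `Language.eclIsoOver P`-substructure.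
[cite: Kirby2010, Lemma 3.3] -/
def Language.eclIsoOver.eclSubstructure (X : Set K) :
    (Language.eclIsoOver P).Substructure K where
  carrier := ecl X
  fun_mem := by
    intro n f v hv
    cases f with
    | add => exact Khovanskii.add_mem_ecl (hv 0) (hv 1)
    | mul => exact Khovanskii.mul_mem_ecl (hv 0) (hv 1)
    | neg => exact Khovanskii.neg_mem_ecl (hv 0)
    | zero => exact Khovanskii.zero_mem_ecl X
    | one => exact Khovanskii.one_mem_ecl X
    | exp => exact Khovanskii.exp_mem_ecl (hv 0)

/-- The carrier of `eclSubstructure X` is `ecl X`. [folklore] -/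
@[simp] theorem Language.eclIsoOver.coe_eclSubstructure
    (X : Set K) :
    ((Language.eclIsoOver.eclSubstructure X : (Language.eclIsoOver P).Substructure K) : Set K) =
      ecl X := rfl

end ClosedSubsets

end ZilberOverUniv

end Literature.NumberTheory.Transcendental
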